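import Mathlib
import Summits.NavierStokesRegularity.NavierStokesRegularity.Theorems.EulerZoomLiouvillePowerGaugeEulerLiouvilleWeakEtaMollified
import Summits.NavierStokesRegularity.NavierStokesRegularity.Theorems.EulerZoomLiouvillePowerGaugeEulerLiouvilleWeakEtaApprox
import Summits.NavierStokesRegularity.NavierStokesRegularity.Theorems.EulerZoomLiouvillePowerGaugeEulerLiouvilleWeakSupportDensityLaw
import Summits.NavierStokesRegularity.NavierStokesRegularity.Theorems.EulerZoomLiouvillePowerGaugeEulerLiouvilleWeakCasimirMass
import HarnessLib

/-!
# Crux `EulerZoomLiouville.PowerGaugeEulerLiouville` (stmt-NavierStokesRegularity-19832), weak stratum, line `weak_axisym` (X1b):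
# the RENORMALISED IDENTITY FOR THE MOLLIFIED CASIMIR

Route №10 `EulerZoomLiouville` (NavierStokesRegularity), crux E = stmt-NavierStokesRegularity-19832; width seat ns-ezl-w1 g9 under the LEAD ns-typeII-p2.
Second step of the DiPerna–Lions renormalisation (`stub_etaRenormalisation`): for `η ∈ L²_loc` with `div(Wη) = (2γ−1)η` in `𝒟′`, `div W = 3γ` in `𝒟′`,
`W ∈ L²_loc`, a test kernel `φ`, `β ∈ C¹` with bounded derivative and a test `ψ`:

  `∫ β(g)(3γψ + Dψ[W]) = ∫ ψ β′(g)((1 − 2γ)g − r)`   for any `g ∈ C¹` with `Dg[W] = r − (1−2γ)g` pointwise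

(applied to `g = η_φ = φ̃ ⋆ η`, `r = r_φ` the commutator of `…WeakEtaMollified`; `div W = 3γ` tested with the `C¹_c` function `ψ·β(g)` —
`integral_fderiv_apply_eq_of_contDiff_one`).  Lemmas: `locallyIntegrable_of_memLp_two_ball`,
`contDiff_normed_convolution`, `hasFDerivAt_beta_comp`, `integrable_test_mul_continuous`, `renormalised_identity_of_transport`
(`η‖W‖ ∈ L¹_loc` is `WeakAxisym.locallyIntegrable_mul_norm` of `…WeakCasimirMass`).
[folklore; DiPernaLions1989 §II.1 (proof of Thm. II.1)]

WHAT THIS IS NOT: not NS, not E, not X1b — the `ε > 0` identity before the limit; 19832 is OPEN.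
-/

noncomputable section

-- flat `Theorems/<Route><Decl>…` files of one crux share the namespace of the crux (tree convention)
set_option linter.dupNamespace false

open MeasureTheory Set Filter Topology Metric Function TopologicalSpace ContinuousLinearMap
open scoped ENNReal NNReal RealInnerProductSpace ContDiff Convolution

namespace Summit.NavierStokesRegularity.NavierStokesRegularity.Theorems.PowerGaugeEulerLiouville.WeakAxisym

open Literature.Analysis Literature.Analysis.FunctionSpaces Literature.Analysis.FluidPDE
open Summit.NavierStokesRegularity.NavierStokesRegularity.Theorems.PowerGaugeEulerLiouville

variable {W : EuclideanSpace ℝ (Fin 3) → EuclideanSpace ℝ (Fin 3)} {η : EuclideanSpace ℝ (Fin 3) → ℝ} {γ : ℝ}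

/-- `L²_loc ⊆ L¹_loc`. [folklore] -/
theorem locallyIntegrable_of_memLp_two_ball
    (hη2 : ∀ r : ℝ, MemLp η 2 (volume.restrict (ball (0 : EuclideanSpace ℝ (Fin 3)) r))) :
    LocallyIntegrable η volume := by
  refine (locallyIntegrable_iff).2 fun K hK => ?_
  obtain ⟨r, hr⟩ := hK.isBounded.subset_ball (0 : EuclideanSpace ℝ (Fin 3))
  haveI : IsFiniteMeasure ((volume : Measure (EuclideanSpace ℝ (Fin 3))).restrict (ball (0 : EuclideanSpace ℝ (Fin 3)) r)) :=
    isFiniteMeasure_restrict.2 measure_ball_lt_top.ne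
  exact IntegrableOn.mono_set (show IntegrableOn η (ball 0 r) volume from (hη2 r).integrable one_le_two) hr

/-- The mollification `φ̃ ⋆ η` of a locally integrable `η` is smooth. [folklore] -/
theorem contDiff_normed_convolution (φ : ContDiffBump (0 : EuclideanSpace ℝ (Fin 3))) (hη : LocallyIntegrable η volume) {n : ℕ∞} :
    ContDiff ℝ n (φ.normed volume ⋆[lsmul ℝ ℝ, volume] η) :=
  φ.hasCompactSupport_normed.contDiff_convolution_left _ φ.contDiff_normed hη

/-- Chain rule `D(β ∘ g)(y)[w] = β′(g y)·Dg(y)[w]` for `β ∈ C¹(ℝ)` and `g ∈ C¹`. [folklore] -/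
theorem hasFDerivAt_beta_comp {β : ℝ → ℝ} (hβ : ContDiff ℝ 1 β) {g : EuclideanSpace ℝ (Fin 3) → ℝ} (hg : ContDiff ℝ 1 g)
    (y : EuclideanSpace ℝ (Fin 3)) : HasFDerivAt (fun y => β (g y)) (deriv β (g y) • fderiv ℝ g y) y :=
  ((hβ.differentiable (by simp) _).hasDerivAt).comp_hasFDerivAt y ((hg.differentiable (by simp)) y).hasFDerivAt

/-- A continuous function times a continuous compactly supported one, paired with `L¹_loc`, is integrable:
`y ↦ a(y)·b(y)·‖W y‖`-type bound. Here: `ψ·g` integrable for `ψ` continuous compactly supported and `g` continuous. [folklore] -/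
theorem integrable_test_mul_continuous {ψ g : EuclideanSpace ℝ (Fin 3) → ℝ} (hψc : Continuous ψ) (hψs : HasCompactSupport ψ)
    (hg : Continuous g) : Integrable (fun y => ψ y * g y) volume :=
  (hψc.mul hg).integrable_of_hasCompactSupport hψs.mul_right

/-- **THE RENORMALISED IDENTITY FOR A CLASSICAL SOLUTION UP TO A DEFECT.**  Let `W ∈ L¹_loc` with `∫⟪W, ∇φ⟫ = −3γ∫φ` for all tests
(`div W = 3γ` in `𝒟′`), let `g ∈ C¹` solve `Dg[W] = r − (1 − 2γ)g` pointwise (the mollified Casimir `g = φ̃ ⋆ η` with its commutator `r`,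
`fderiv_convolution_apply_transport_eq`), `β ∈ C¹`, `ψ` a test.  Then
`∫ β(g)(3γψ + Dψ[W]) = ∫ ψ β′(g)((1 − 2γ)g − r)`  (`div W = 3γ` tested with the `C¹_c` function `ψ·β(g)`).
[folklore; DiPernaLions1989 §II.1 (proof of Thm. II.1)] -/
theorem renormalised_identity_of_transport (hWl : LocallyIntegrable W volume)
    (hdiv : ∀ θ : EuclideanSpace ℝ (Fin 3) → ℝ, IsTestFunctionOn (⊤ : Opens (EuclideanSpace ℝ (Fin 3))) θ →
      ∫ y, ⟪W y, gradient θ y⟫ = -(3 * γ) * ∫ y, θ y)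
    {g r : EuclideanSpace ℝ (Fin 3) → ℝ} (hg : ContDiff ℝ 1 g) (hgr : ∀ y, fderiv ℝ g y (W y) = r y - (1 - 2 * γ) * g y)
    {β : ℝ → ℝ} (hβ : ContDiff ℝ 1 β)
    {ψ : EuclideanSpace ℝ (Fin 3) → ℝ} (hψ : IsTestFunctionOn (⊤ : Opens (EuclideanSpace ℝ (Fin 3))) ψ) :
    ∫ y, β (g y) * (3 * γ * ψ y + fderiv ℝ ψ y (W y)) = ∫ y, ψ y * (deriv β (g y) * ((1 - 2 * γ) * g y - r y)) := by
  -- ### data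
  have hgc : Continuous g := hg.continuous
  have hDgc : Continuous (fderiv ℝ g) := hg.continuous_fderiv one_ne_zero
  have hψc : Continuous ψ := hψ.contDiff.continuous
  have hDψc : Continuous (fderiv ℝ ψ) := hψ.contDiff.continuous_fderiv (by simp)
  have hβc : Continuous β := hβ.continuous
  have hβ'c : Continuous (deriv β) := hβ.continuous_deriv le_rfl
  -- ### the `C¹_c` test `θ = ψ · β(g)`
  have hβg : ContDiff ℝ 1 (fun y => β (g y)) := hβ.comp hg
  have hθ1 : ContDiff ℝ 1 (fun y => ψ y * β (g y)) := (hψ.contDiff.of_le (by norm_cast)).mul hβg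
  have hθs : HasCompactSupport (fun y => ψ y * β (g y)) := by
    refine hψ.hasCompactSupport.mono fun y hy => ?_
    rw [mem_support] at hy ⊢
    intro h; exact hy (by rw [h, zero_mul])
  have hDθ : ∀ y w, fderiv ℝ (fun y => ψ y * β (g y)) y w = β (g y) * fderiv ℝ ψ y w + ψ y * (deriv β (g y) * fderiv ℝ g y w) := by
    intro y w
    have h1 : HasFDerivAt ψ (fderiv ℝ ψ y) y := ((hψ.contDiff.differentiable (by simp)) y).hasFDerivAt
    have h2 : HasFDerivAt (fun y => β (g y)) (deriv β (g y) • fderiv ℝ g y) y := hasFDerivAt_beta_comp hβ hg y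
    have h3 : HasFDerivAt (fun y => ψ y * β (g y)) (ψ y • (deriv β (g y) • fderiv ℝ g y) + β (g y) • fderiv ℝ ψ y) y := h1.mul h2
    rw [h3.fderiv]
    simp only [_root_.add_apply, _root_.smul_apply, smul_eq_mul]
    ring
  have hdivθ : ∫ y, fderiv ℝ (fun y => ψ y * β (g y)) y (W y) = -(3 * γ) * ∫ y, ψ y * β (g y) :=
    integral_fderiv_apply_eq_of_contDiff_one (c := 3 * γ) hWl hdiv hθ1 hθs
  -- ### integrability of the pieces
  have hL1c : Continuous fun y => β (g y) • fderiv ℝ ψ y := (hβc.comp hgc).smul hDψc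
  have hL1s : HasCompactSupport fun y => β (g y) • fderiv ℝ ψ y := by
    refine (hψ.hasCompactSupport.fderiv (𝕜 := ℝ)).mono fun y hy => ?_
    rw [mem_support] at hy ⊢
    intro h; exact hy (by rw [h, smul_zero])
  have hI1 : Integrable (fun y => β (g y) * fderiv ℝ ψ y (W y)) volume := by
    have h := WeakEulerian.integrable_clm_apply_of_locallyIntegrable hL1c hL1s hWl
    refine h.congr (Eventually.of_forall fun y => ?_)
    simp only [_root_.smul_apply, smul_eq_mul]
  have hL2c : Continuous fun y => (ψ y * deriv β (g y)) • fderiv ℝ g y := (hψc.mul (hβ'c.comp hgc)).smul hDgc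
  have hL2s : HasCompactSupport fun y => (ψ y * deriv β (g y)) • fderiv ℝ g y := by
    refine hψ.hasCompactSupport.mono fun y hy => ?_
    rw [mem_support] at hy ⊢
    intro h; exact hy (by rw [h, zero_mul, zero_smul])
  have hI2 : Integrable (fun y => ψ y * (deriv β (g y) * fderiv ℝ g y (W y))) volume := by
    have h := WeakEulerian.integrable_clm_apply_of_locallyIntegrable hL2c hL2s hWl
    refine h.congr (Eventually.of_forall fun y => ?_)
    simp only [_root_.smul_apply, smul_eq_mul]
    ring
  have hI3 : Integrable (fun y => ψ y * β (g y)) volume := integrable_test_mul_continuous hψc hψ.hasCompactSupport (hβc.comp hgc)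
  -- ### the divergence identity, expanded
  have e1 : ∫ y, fderiv ℝ (fun y => ψ y * β (g y)) y (W y) =
      (∫ y, β (g y) * fderiv ℝ ψ y (W y)) + ∫ y, ψ y * (deriv β (g y) * fderiv ℝ g y (W y)) := by
    rw [← integral_add hI1 hI2]
    exact integral_congr_ae (Eventually.of_forall fun y => hDθ y (W y))
  rw [e1] at hdivθ
  -- ### the two sides
  have eL : ∫ y, β (g y) * (3 * γ * ψ y + fderiv ℝ ψ y (W y)) =
      3 * γ * (∫ y, ψ y * β (g y)) + ∫ y, β (g y) * fderiv ℝ ψ y (W y) := by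
    rw [← integral_const_mul, ← integral_add (hI3.const_mul _) hI1]
    refine integral_congr_ae (Eventually.of_forall fun y => ?_)
    ring
  have eR : ∫ y, ψ y * (deriv β (g y) * ((1 - 2 * γ) * g y - r y)) = -∫ y, ψ y * (deriv β (g y) * fderiv ℝ g y (W y)) := by
    rw [← integral_neg]
    refine integral_congr_ae (Eventually.of_forall fun y => ?_)
    dsimp only
    rw [hgr y]
    ring
  rw [eL, eR]
  linarith

end Summit.NavierStokesRegularity.NavierStokesRegularity.Theorems.PowerGaugeEulerLiouville.WeakAxisym

end
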